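import Literature.Geometry.Lorentzian.Stationary
import Mathlib.Analysis.Calculus.ContDiff.FiniteDimension
import HarnessLib

/-!
# Crux `HawkingExtensionIsKerr` (stmt-FinalStateConjecture-17840), line `SketchIdeator2` —
# programme HR (horizon regularity), step G: the slope field of the null hyperplanes `K^⊥`, read
# in a chart, is smooth

Helper file of the line lead (c4).  For a smooth vector field `K` on an open set `U` of the
space-time of a `StationaryAFBlackHole` and the extended chart `φ = φ_p` with tangent-bundle
trivialization `e = e_p`, the chart-read pairings `x ↦ g_x(e_x⁻¹ u, K_x)` (`u` a fixed chart
vector) are smooth on `U ∩ (chart domain)` (`contMDiffOn_val_symmL_apply`), hence along the affine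
chart family `(y, t) ↦ φ⁻¹(z₀ + B y + t v)` they are `C^∞` functions of `(y, t)`
(`contDiffOn_val_symmL_apply_line`), and so is the field of linear forms
`G(y, t) = −g(e⁻¹ v, K)⁻¹ g(K, e⁻¹(B ·))` (the slope of the null hyperplane `K^⊥` over the
transverse coordinates) on the open set where the denominator does not vanish
(`contDiffOn_slopeField`, `isOpen_slopeDomain`).  This is the input `G ∈ C^∞` of the bootstrap
`Du = G(·, u) ⇒ u ∈ C^∞` (stub HR-B) in the lead's assembly of the local defining functions of
the horizon.
-/

noncomputable section

set_option linter.dupNamespace false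

namespace Summit.FinalStateConjecture.FinalStateConjecture.Theorems.HawkingExtensionIsKerr.SketchIdeator2

open Set Filter Metric Bundle Function Literature.Geometry.Lorentzian
open scoped Manifold ContDiff Topology

/-- **The constant-coordinate local frame fields of a tangent-bundle trivialization are smooth**:
for a fixed chart vector `u`, the section `x ↦ e_p(x)⁻¹ u` is `C^∞` on the base set of `e_p`
(its `e_p`-coordinate is the constant `u`; Mathlib `Trivialization.contMDiffOn_section_iff`).
[folklore] -/
theorem contMDiffOn_symmL_const (𝓑 : StationaryAFBlackHole.{0}) (p : 𝓑.carrier) (u : E4) :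
    ContMDiffOn (𝓡 4) ((𝓡 4).prod 𝓘(ℝ, E4)) ∞
      (fun x ↦ (TotalSpace.mk' E4 x
        ((trivializationAt E4 (TangentSpace (𝓡 4)) p).symmL ℝ x u) : TangentBundle (𝓡 4) 𝓑.carrier))
      (trivializationAt E4 (TangentSpace (𝓡 4)) p).baseSet := by
  set e := trivializationAt E4 (TangentSpace (𝓡 4)) p with he
  rw [e.contMDiffOn_section_iff e.open_baseSet subset_rfl]
  refine (contMDiffOn_const (c := u)).congr fun x hx ↦ ?_
  change (e ⟨x, e.symmL ℝ x u⟩).2 = u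
  rw [← e.continuousLinearMapAt_apply_of_mem (R := ℝ) hx, e.continuousLinearMapAt_symmL hx]

/-- **The chart-read pairing `x ↦ g_x(e_p(x)⁻¹ u, K_x)` is smooth** on `U ∩ (chart domain of p)`
for a smooth field `K` on the open set `U` and a fixed chart vector `u` (the metric is a smooth
section of the bundle of bilinear forms; Mathlib `ContMDiffWithinAt.clm_bundle_apply₂`).
[folklore] -/
theorem contMDiffOn_val_symmL_apply (𝓑 : StationaryAFBlackHole.{0}) {U : Set 𝓑.carrier}
    {K : Π x : 𝓑.carrier, TangentSpace (𝓡 4) x} (hU : IsOpen U)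
    (hK : ContMDiffOn (𝓡 4) ((𝓡 4).prod 𝓘(ℝ, E4)) ∞
      (fun x ↦ (TotalSpace.mk' E4 x (K x) : TangentBundle (𝓡 4) 𝓑.carrier)) U)
    (p : 𝓑.carrier) (u : E4) :
    ContMDiffOn (𝓡 4) 𝓘(ℝ, ℝ) ∞
      (fun x ↦ 𝓑.metric.val x ((trivializationAt E4 (TangentSpace (𝓡 4)) p).symmL ℝ x u) (K x))
      (U ∩ (trivializationAt E4 (TangentSpace (𝓡 4)) p).baseSet) := by
  set e := trivializationAt E4 (TangentSpace (𝓡 4)) p with he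
  have hO : IsOpen (U ∩ e.baseSet) := hU.inter e.open_baseSet
  intro x hx
  have h2 : ContMDiffWithinAt (𝓡 4) ((𝓡 4).prod 𝓘(ℝ, E4)) ∞
      (fun x ↦ (TotalSpace.mk' E4 x (e.symmL ℝ x u) : TangentBundle (𝓡 4) 𝓑.carrier))
      (U ∩ e.baseSet) x :=
    ((contMDiffOn_symmL_const 𝓑 p u) x hx.2).mono inter_subset_right
  have h3 : ContMDiffWithinAt (𝓡 4) ((𝓡 4).prod 𝓘(ℝ, E4)) ∞
      (fun x ↦ (TotalSpace.mk' E4 x (K x) : TangentBundle (𝓡 4) 𝓑.carrier)) (U ∩ e.baseSet) x :=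
    (hK x hx.1).mono inter_subset_left
  have hg0 : ContMDiffWithinAt (𝓡 4) ((𝓡 4).prod 𝓘(ℝ, E4 →L[ℝ] E4 →L[ℝ] ℝ)) ∞
      (fun b ↦ TotalSpace.mk' (E4 →L[ℝ] E4 →L[ℝ] ℝ) b (𝓑.metric.val b)) (U ∩ e.baseSet) x :=
    (𝓑.metric.contMDiff x).contMDiffWithinAt
  have := hg0.clm_bundle_apply₂ (F₁ := E4) (F₂ := E4) h2 h3
  simp only [contMDiffWithinAt_totalSpace] at this
  exact this.2

/-- **The pairings along the affine chart family are `C^∞` functions of the coordinates**: for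
`B : ℝ³ → ℝ⁴` continuous linear and chart vectors `z₀`, `v`, `u`, the function
`(y, t) ↦ g_x(e_p(x)⁻¹ u, K_x)`, `x = φ_p⁻¹(z₀ + B y + t v)`, is `C^∞` on the open set of `(y, t)`
whose chart point lies in the target of `φ_p` and is mapped into `U` (composition with the smooth
inverse extended chart, `contMDiffOn_extChartAt_symm`). [folklore] -/
theorem contDiffOn_val_symmL_apply_line (𝓑 : StationaryAFBlackHole.{0}) {U : Set 𝓑.carrier}
    {K : Π x : 𝓑.carrier, TangentSpace (𝓡 4) x} (hU : IsOpen U)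
    (hK : ContMDiffOn (𝓡 4) ((𝓡 4).prod 𝓘(ℝ, E4)) ∞
      (fun x ↦ (TotalSpace.mk' E4 x (K x) : TangentBundle (𝓡 4) 𝓑.carrier)) U)
    (p : 𝓑.carrier) (B : E3 →L[ℝ] E4) (z₀ v u : E4) :
    ContDiffOn ℝ ∞
      (fun w : E3 × ℝ ↦ 𝓑.metric.val ((extChartAt (𝓡 4) p).symm (z₀ + B w.1 + w.2 • v))
        ((trivializationAt E4 (TangentSpace (𝓡 4)) p).symmL ℝ
          ((extChartAt (𝓡 4) p).symm (z₀ + B w.1 + w.2 • v)) u)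
        (K ((extChartAt (𝓡 4) p).symm (z₀ + B w.1 + w.2 • v))))
      {w : E3 × ℝ | z₀ + B w.1 + w.2 • v ∈ (extChartAt (𝓡 4) p).target ∧
        (extChartAt (𝓡 4) p).symm (z₀ + B w.1 + w.2 • v) ∈ U} := by
  set e := trivializationAt E4 (TangentSpace (𝓡 4)) p with he
  set φ := extChartAt (𝓡 4) p with hφ
  set Ω₀ : Set (E3 × ℝ) := {w | z₀ + B w.1 + w.2 • v ∈ φ.target ∧ φ.symm (z₀ + B w.1 + w.2 • v) ∈ U}
  -- the affine map and the inverse chart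
  have haff : ContMDiffOn 𝓘(ℝ, E3 × ℝ) 𝓘(ℝ, E4) ∞ (fun w : E3 × ℝ ↦ z₀ + B w.1 + w.2 • v) Ω₀ := by
    rw [contMDiffOn_iff_contDiffOn]
    have : ContDiff ℝ ∞ (fun w : E3 × ℝ ↦ z₀ + B w.1 + w.2 • v) := by fun_prop
    exact this.contDiffOn
  have hsymm : ContMDiffOn 𝓘(ℝ, E4) (𝓡 4) ∞ φ.symm φ.target := contMDiffOn_extChartAt_symm p
  have hcomp : ContMDiffOn 𝓘(ℝ, E3 × ℝ) (𝓡 4) ∞ (fun w : E3 × ℝ ↦ φ.symm (z₀ + B w.1 + w.2 • v)) Ω₀ :=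
    hsymm.comp haff fun w hw ↦ hw.1
  have hΨ := contMDiffOn_val_symmL_apply 𝓑 hU hK p u
  have hmaps : MapsTo (fun w : E3 × ℝ ↦ φ.symm (z₀ + B w.1 + w.2 • v)) Ω₀ (U ∩ e.baseSet) := by
    intro w hw
    refine ⟨hw.2, ?_⟩
    rw [he, TangentBundle.trivializationAt_baseSet, ← extChartAt_source (𝓡 4)]
    exact φ.map_target hw.1
  have h := hΨ.comp hcomp hmaps
  rw [contMDiffOn_iff_contDiffOn] at h
  exact h

/-- **The domain of the slope field is open**: the set of coordinates `(y, t)` whose chart point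
lies in the chart target, is mapped into `U`, and at which the pairing `g(e⁻¹ v, K)` does not
vanish. [folklore] -/
theorem isOpen_slopeDomain (𝓑 : StationaryAFBlackHole.{0}) {U : Set 𝓑.carrier}
    {K : Π x : 𝓑.carrier, TangentSpace (𝓡 4) x} (hU : IsOpen U)
    (hK : ContMDiffOn (𝓡 4) ((𝓡 4).prod 𝓘(ℝ, E4)) ∞
      (fun x ↦ (TotalSpace.mk' E4 x (K x) : TangentBundle (𝓡 4) 𝓑.carrier)) U)
    (p : 𝓑.carrier) (B : E3 →L[ℝ] E4) (z₀ v : E4) :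
    IsOpen {w : E3 × ℝ | (z₀ + B w.1 + w.2 • v ∈ (extChartAt (𝓡 4) p).target ∧
        (extChartAt (𝓡 4) p).symm (z₀ + B w.1 + w.2 • v) ∈ U) ∧
        𝓑.metric.val ((extChartAt (𝓡 4) p).symm (z₀ + B w.1 + w.2 • v))
          ((trivializationAt E4 (TangentSpace (𝓡 4)) p).symmL ℝ
            ((extChartAt (𝓡 4) p).symm (z₀ + B w.1 + w.2 • v)) v)
          (K ((extChartAt (𝓡 4) p).symm (z₀ + B w.1 + w.2 • v))) ≠ 0} := by
  set φ := extChartAt (𝓡 4) p with hφ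
  have hcont : Continuous (fun w : E3 × ℝ ↦ z₀ + B w.1 + w.2 • v) := by fun_prop
  have hT : IsOpen (φ.target ∩ φ.symm ⁻¹' U) :=
    (continuousOn_extChartAt_symm p).isOpen_inter_preimage (isOpen_extChartAt_target p) hU
  have hΩ₀ : IsOpen {w : E3 × ℝ | z₀ + B w.1 + w.2 • v ∈ φ.target ∧ φ.symm (z₀ + B w.1 + w.2 • v) ∈ U} :=
    hT.preimage hcont
  have hc := (contDiffOn_val_symmL_apply_line 𝓑 hU hK p B z₀ v v).continuousOn
  exact hc.isOpen_inter_preimage hΩ₀ isOpen_ne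

/-- **Step G: the slope field `G(y, t) = −g(e⁻¹ v, K)⁻¹ • g(K, e⁻¹(B ·))` of the null
hyperplanes `K^⊥` over the transverse coordinates is `C^∞`** on its (open) domain — a family of
continuous linear forms on `ℝ³` all of whose evaluations are `C^∞` (Mathlib `contDiffOn_clm_apply`,
`ℝ³` finite-dimensional), divided by a non-vanishing `C^∞` function. [folklore] -/
theorem contDiffOn_slopeField (𝓑 : StationaryAFBlackHole.{0}) {U : Set 𝓑.carrier}
    {K : Π x : 𝓑.carrier, TangentSpace (𝓡 4) x} (hU : IsOpen U)
    (hK : ContMDiffOn (𝓡 4) ((𝓡 4).prod 𝓘(ℝ, E4)) ∞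
      (fun x ↦ (TotalSpace.mk' E4 x (K x) : TangentBundle (𝓡 4) 𝓑.carrier)) U)
    (p : 𝓑.carrier) (B : E3 →L[ℝ] E4) (z₀ v : E4) :
    ContDiffOn ℝ ∞
      (fun w : E3 × ℝ ↦
        -(𝓑.metric.val ((extChartAt (𝓡 4) p).symm (z₀ + B w.1 + w.2 • v))
          ((trivializationAt E4 (TangentSpace (𝓡 4)) p).symmL ℝ
            ((extChartAt (𝓡 4) p).symm (z₀ + B w.1 + w.2 • v)) v)
          (K ((extChartAt (𝓡 4) p).symm (z₀ + B w.1 + w.2 • v))))⁻¹ •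
        ((𝓑.metric.val ((extChartAt (𝓡 4) p).symm (z₀ + B w.1 + w.2 • v))
          (K ((extChartAt (𝓡 4) p).symm (z₀ + B w.1 + w.2 • v)))).comp
          (((trivializationAt E4 (TangentSpace (𝓡 4)) p).symmL ℝ
            ((extChartAt (𝓡 4) p).symm (z₀ + B w.1 + w.2 • v))).comp B)))
      {w : E3 × ℝ | (z₀ + B w.1 + w.2 • v ∈ (extChartAt (𝓡 4) p).target ∧
        (extChartAt (𝓡 4) p).symm (z₀ + B w.1 + w.2 • v) ∈ U) ∧
        𝓑.metric.val ((extChartAt (𝓡 4) p).symm (z₀ + B w.1 + w.2 • v))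
          ((trivializationAt E4 (TangentSpace (𝓡 4)) p).symmL ℝ
            ((extChartAt (𝓡 4) p).symm (z₀ + B w.1 + w.2 • v)) v)
          (K ((extChartAt (𝓡 4) p).symm (z₀ + B w.1 + w.2 • v))) ≠ 0} := by
  set e := trivializationAt E4 (TangentSpace (𝓡 4)) p with he
  set φ := extChartAt (𝓡 4) p with hφ
  -- the denominator
  have hden : ContDiffOn ℝ ∞ (fun w : E3 × ℝ ↦ (𝓑.metric.val (φ.symm (z₀ + B w.1 + w.2 • v))
      (e.symmL ℝ (φ.symm (z₀ + B w.1 + w.2 • v)) v) (K (φ.symm (z₀ + B w.1 + w.2 • v))))⁻¹)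
      {w : E3 × ℝ | (z₀ + B w.1 + w.2 • v ∈ φ.target ∧ φ.symm (z₀ + B w.1 + w.2 • v) ∈ U) ∧
        𝓑.metric.val (φ.symm (z₀ + B w.1 + w.2 • v)) (e.symmL ℝ (φ.symm (z₀ + B w.1 + w.2 • v)) v)
          (K (φ.symm (z₀ + B w.1 + w.2 • v))) ≠ 0} :=
    ((contDiffOn_val_symmL_apply_line 𝓑 hU hK p B z₀ v v).mono (fun w hw ↦ hw.1)).inv
      (fun w hw ↦ hw.2)
  -- the numerator, a family of linear forms
  have hnum : ContDiffOn ℝ ∞ (fun w : E3 × ℝ ↦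
      (𝓑.metric.val (φ.symm (z₀ + B w.1 + w.2 • v)) (K (φ.symm (z₀ + B w.1 + w.2 • v)))).comp
        ((e.symmL ℝ (φ.symm (z₀ + B w.1 + w.2 • v))).comp B))
      {w : E3 × ℝ | (z₀ + B w.1 + w.2 • v ∈ φ.target ∧ φ.symm (z₀ + B w.1 + w.2 • v) ∈ U) ∧
        𝓑.metric.val (φ.symm (z₀ + B w.1 + w.2 • v)) (e.symmL ℝ (φ.symm (z₀ + B w.1 + w.2 • v)) v)
          (K (φ.symm (z₀ + B w.1 + w.2 • v))) ≠ 0} := by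
    rw [contDiffOn_clm_apply]
    intro hvec
    have h := (contDiffOn_val_symmL_apply_line 𝓑 hU hK p B z₀ v (B hvec)).mono
      (s := {w : E3 × ℝ | z₀ + B w.1 + w.2 • v ∈ φ.target ∧ φ.symm (z₀ + B w.1 + w.2 • v) ∈ U})
      (t := {w : E3 × ℝ | (z₀ + B w.1 + w.2 • v ∈ φ.target ∧ φ.symm (z₀ + B w.1 + w.2 • v) ∈ U) ∧
        𝓑.metric.val (φ.symm (z₀ + B w.1 + w.2 • v)) (e.symmL ℝ (φ.symm (z₀ + B w.1 + w.2 • v)) v)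
          (K (φ.symm (z₀ + B w.1 + w.2 • v))) ≠ 0}) (fun w hw ↦ hw.1)
    refine h.congr fun w _ ↦ ?_
    simp only [ContinuousLinearMap.comp_apply]
    exact 𝓑.metric.symm _ _ _
  exact (hden.neg.smul hnum).congr fun w _ ↦ rfl

/-- **Registered sub-goal form of step G** (closed statement, crux stmt-FinalStateConjecture-17840):
the slope field of the null hyperplanes over the transverse coordinates has an open domain and is
`C^∞` there. -/
theorem stub_hr_slopeField : ∀ (𝓑 : StationaryAFBlackHole.{0}) (U : Set 𝓑.carrier) (K : Π x : 𝓑.carrier, TangentSpace (𝓡 4) x) (p : 𝓑.carrier) (B : E3 →L[ℝ] E4) (z₀ v : E4), IsOpen U → ContMDiffOn (𝓡 4) ((𝓡 4).prod 𝓘(ℝ, E4)) ((⊤ : ℕ∞) : WithTop ℕ∞) (fun x ↦ (Bundle.TotalSpace.mk' E4 x (K x) : TangentBundle (𝓡 4) 𝓑.carrier)) U → IsOpen {w : E3 × ℝ | (z₀ + B w.1 + w.2 • v ∈ (extChartAt (𝓡 4) p).target ∧ (extChartAt (𝓡 4) p).symm (z₀ + B w.1 + w.2 • v) ∈ U) ∧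 𝓑.metric.val ((extChartAt (𝓡 4) p).symm (z₀ + B w.1 + w.2 • v)) ((trivializationAt E4 (TangentSpace (𝓡 4)) p).symmL ℝ ((extChartAt (𝓡 4) p).symm (z₀ + B w.1 + w.2 • v)) v) (K ((extChartAt (𝓡 4) p).symm (z₀ + B w.1 + w.2 • v))) ≠ 0} ∧ ContDiffOn ℝ ((⊤ : ℕ∞) : WithTop ℕ∞) (fun w : E3 × ℝ ↦ -(𝓑.metric.val ((extChartAt (𝓡 4) p).symm (z₀ + B w.1 + w.2 • v)) ((trivializationAt E4 (TangentSpace (𝓡 4)) p).symmL ℝ ((extChartAt (𝓡 4) p).symm (z₀ + B w.1 + w.2 • v)) v) (K ((extChartAt (𝓡 4) p).symm (z₀ + B w.1 + w.2 • v))))⁻¹ • ((𝓑.metric.val ((extChartAt (𝓡 4) p).symm (z₀ + B w.1 + w.2 • v)) (K ((extChartAt (𝓡 4) p).symm (z₀ + B w.1 + w.2 • v)))).comp (((trivializationAt E4 (TangentSpace (𝓡 4)) p).symmL ℝ ((extChartAt (𝓡 4) p).symm (z₀ + B w.1 + w.2 • v))).comp B))) {w : E3 × ℝ | (z₀ + B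 w.1 + w.2 • v ∈ (extChartAt (𝓡 4) p).target ∧ (extChartAt (𝓡 4) p).symm (z₀ + B w.1 + w.2 • v) ∈ U) ∧ 𝓑.metric.val ((extChartAt (𝓡 4) p).symm (z₀ + B w.1 + w.2 • v)) ((trivializationAt E4 (TangentSpace (𝓡 4)) p).symmL ℝ ((extChartAt (𝓡 4) p).symm (z₀ + B w.1 + w.2 • v)) v) (K ((extChartAt (𝓡 4) p).symm (z₀ + B w.1 + w.2 • v))) ≠ 0} :=
  fun 𝓑 _ _ p B z₀ v hU hK ↦ ⟨isOpen_slopeDomain 𝓑 hU hK p B z₀ v, contDiffOn_slopeField 𝓑 hU hK p B z₀ v⟩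

end Summit.FinalStateConjecture.FinalStateConjecture.Theorems.HawkingExtensionIsKerr.SketchIdeator2

end
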